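import Summits.QuantumFields.YangMills.Theorems.BalabanUVNodesN21ProjectedCentreDilation

/-!
# N21 (NE7c) · part 34's `hRT` for a statistic POSITIVELY (SUPER-)HOMOGENEOUS OF DEGREE 1 about the dilation centre —
# rate `κ₀ = 1` (plan START-LIST §n21 item 4 (w-c), offered to this seat by dag-n21-e g17, bus l.25213)

Width seat `pub-ymgap-dag-n21-w3` (g0), node N21 = NE7c (NOT PRINTED in [Bałaban 1983–89], NOT proved), lane K3⁷
`SpineGivenEndpointR13SepCoPH` (stmt-QuantumFields-20544, `--kind proof --supports … --as helper`).  Companion of this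
seat's response road (`…N21ResponseRadialTransversality` p583660: the general quadratic-remainder response, rate `κ₀`
from the numeral `c₀ + 4MR² ≤ (1 − κ₀)θ(1−ρ)`); consumes part 34 `…N21ProjectedCentreDilation`
(`slotAntiConcentration_restrict_of_projectedCentre`, dag-n21-d) BY NAME.

WHAT.  The cheapest producer of part 34's radial-transversality binder `hRT`: if the tested statistic is positively
SUPER-HOMOGENEOUS of degree 1 along the rays from the dilation centre inside the cut —
`s·U(z, w) ≤ U(z, c z + s•(w − c z))` for `s ≥ 1` (equality for a statistic 1-homogeneous about `c z`, e.g. a norm or a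
cube sup of norms of LINEAR readings of `w − c z`: part 16's device (α) about a general centre) — then on the shell
`{θ(1−ρ) ≤ U}` one has `U(dilate) − U(p) ≥ (s − 1)U(p) ≥ (s − 1)θ(1−ρ)`: `hRT` with the rate `κ₀ = 1`, no numeral, no
letters.  This is the `c₀ = 0`, `M = 0` corner of the response road, stated under the weaker ray-wise hypothesis.
* §1 ★ `hRT_of_superhomogeneous` (part 34's binder shape verbatim, `κ₀ = 1`, product frame `X × V`);
  `superhomogeneous_of_linear_norm` (`U p = ‖A p.1 (p.2 − c p.1)‖`), `superhomogeneous_of_iSup_linear_norm` (cube sup of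
  linear readings about the centre) — the two standard instances, with EQUALITY.
* §2 ★★ `slotAntiConcentration_restrict_of_projectedCentre_superhomogeneous`: part 34's (M1) about the A-projected centre
  with `hRT` DISCHARGED at `κ₀ = 1` — constant `3(#κ+1)(1+Q)∕(1·(1−ρ))`; other binders displayed unchanged (LOCATED
  junction; A2: joint system not exhibited here — the joint witnesses of this seat's Sanity file p589278 have `κ₀ < 1`).
* §3 A2/A6 `superhomogeneous_letters_inhabited`: the sup-norm statistic `U p = ‖p.2 − c p.1‖` on `Fin 2 → ℝ` about a
  non-zero centre satisfies the hypothesis (with equality) and is not identically zero on the cut.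

HONEST FRAMING.  [textbook]; nothing of Bałaban's asserted; the identification «tested variable 1-homogeneous about the
projected centre» is the LINEARISED reading (lens N213 (α) first rung) — located, NOT asserted; NE7c NOT PRINTED ∕ NOT
proved; N21 NOT discharged; counts unmoved (typed 28∕28 · discharged 5∕27); count-neutral; one finite 𝕋⁴ at fixed ε —
YM mass gap (Clay) is NOT proved by any of this: R4 closes the conditional finite-𝕋⁴ rung `BalabanLadder.UV` only;
nothing continuum ∕ ℝ⁴ ∕ OS ∕ mass gap ∕ Clay.
-/

open MeasureTheory Set Function Matrix
open scoped ENNReal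

namespace Summit.QuantumFields.YangMills.Theorems.N21HomogeneousStatisticRadialTransversality

open Literature.MathematicalPhysics.QuantumFieldTheory.Balaban1983to89.T4ShellMeasure (SlotAntiConcentration)
open Summit.QuantumFields.YangMills.Theorems.N21ProjectedCentreDilation
  (slotAntiConcentration_restrict_of_projectedCentre)

/-! ## §1  `hRT` at rate `κ₀ = 1` from ray-wise super-homogeneity about the centre -/

section Frame

variable {X V : Type*} [AddCommGroup V] [Module ℝ V]

/-- ★ **PART 34's BINDER `hRT` AT RATE `κ₀ = 1` FOR A SUPER-HOMOGENEOUS STATISTIC**: if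
`s·U p ≤ U(p.1, c p.1 + s•(p.2 − c p.1))` for `p ∈ C`, `s ≥ 1` with the dilate in `C`, then for shell points
(`θ(1−ρ) ≤ U p`) `U p + 1·θ(1−ρ)·(s − 1) ≤ U(dilate)` — part 34's `hRT` verbatim with `κ₀ = 1`. [textbook] -/
theorem hRT_of_superhomogeneous (U : X × V → ℝ) (c : X → V) {C : Set (X × V)} {θ ρ : ℝ}
    (hhom : ∀ p ∈ C, ∀ s : ℝ, 1 ≤ s → (p.1, c p.1 + s • (p.2 - c p.1)) ∈ C →
      s * U p ≤ U (p.1, c p.1 + s • (p.2 - c p.1))) :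
    ∀ p : X × V, θ * (1 - ρ) ≤ U p → U p < θ → p ∈ C → ∀ s : ℝ, 1 ≤ s →
      θ * (1 - ρ) ≤ U (p.1, c p.1 + s • (p.2 - c p.1)) → U (p.1, c p.1 + s • (p.2 - c p.1)) < θ →
        (p.1, c p.1 + s • (p.2 - c p.1)) ∈ C →
          U p + 1 * (θ * (1 - ρ)) * (s - 1) ≤ U (p.1, c p.1 + s • (p.2 - c p.1)) := by
  intro p hlo _ hpC s hs _ _ hsC
  have h := hhom p hpC s hs hsC
  have hs0 : 0 ≤ s - 1 := by linarith
  have : (s - 1) * (θ * (1 - ρ)) ≤ (s - 1) * U p := mul_le_mul_of_nonneg_left hlo hs0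
  nlinarith

variable {E : Type*} [NormedAddCommGroup E] [NormedSpace ℝ E]

/-- the norm of a LINEAR reading of `w − c z` is 1-homogeneous about the centre (equality, all `s ≥ 0`). [textbook] -/
theorem superhomogeneous_of_linear_norm (A : X → V →ₗ[ℝ] E) (c : X → V) (p : X × V) {s : ℝ} (hs : 0 ≤ s) :
    s * ‖A p.1 (p.2 - c p.1)‖ = ‖A p.1 ((c p.1 + s • (p.2 - c p.1)) - c p.1)‖ := by
  rw [add_sub_cancel_left, map_smul, norm_smul, Real.norm_of_nonneg hs]

/-- a CUBE SUP of norms of linear readings of `w − c z` is 1-homogeneous about the centre (equality, `s ≥ 0`).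
[textbook] -/
theorem superhomogeneous_of_iSup_linear_norm {P : Type*} [Fintype P] [Nonempty P] (A : P → X → V →ₗ[ℝ] E)
    (c : X → V) (p : X × V) {s : ℝ} (hs : 0 ≤ s) :
    s * (⨆ q, ‖A q p.1 (p.2 - c p.1)‖) = ⨆ q, ‖A q p.1 ((c p.1 + s • (p.2 - c p.1)) - c p.1)‖ := by
  rw [Real.mul_iSup_of_nonneg hs]
  exact iSup_congr fun q => superhomogeneous_of_linear_norm (A q) c p hs

/-- the cube-sup instance packaged as part 34's `hRT` (rate `1`), any cut `C`. [textbook] -/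
theorem hRT_of_iSup_linear_norm {P : Type*} [Fintype P] [Nonempty P] (A : P → X → V →ₗ[ℝ] E) (c : X → V)
    (C : Set (X × V)) (θ ρ : ℝ) :
    ∀ p : X × V, θ * (1 - ρ) ≤ (⨆ q, ‖A q p.1 (p.2 - c p.1)‖) → (⨆ q, ‖A q p.1 (p.2 - c p.1)‖) < θ → p ∈ C →
      ∀ s : ℝ, 1 ≤ s →
      θ * (1 - ρ) ≤ (⨆ q, ‖A q p.1 ((c p.1 + s • (p.2 - c p.1)) - c p.1)‖) →
        (⨆ q, ‖A q p.1 ((c p.1 + s • (p.2 - c p.1)) - c p.1)‖) < θ →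
          (p.1, c p.1 + s • (p.2 - c p.1)) ∈ C →
          (⨆ q, ‖A q p.1 (p.2 - c p.1)‖) + 1 * (θ * (1 - ρ)) * (s - 1)
            ≤ ⨆ q, ‖A q p.1 ((c p.1 + s • (p.2 - c p.1)) - c p.1)‖ :=
  hRT_of_superhomogeneous (fun p : X × V => ⨆ q, ‖A q p.1 (p.2 - c p.1)‖) c
    fun p _ s hs _ => (superhomogeneous_of_iSup_linear_norm A c p (by linarith)).le

end Frame

/-! ## §2  Part 34's (M1) about the A-projected centre with `hRT` DISCHARGED at rate `1` -/

section Junction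

variable {X : Type*} [MeasurableSpace X] {κ : Type*} [Fintype κ]

/-- ★★ **(M1) ON THE CUT LAW ABOUT THE A-PROJECTED CENTRE FOR A SUPER-HOMOGENEOUS STATISTIC** (part 34 BY NAME, `hRT`
replaced by ray-wise super-homogeneity about the centre inside the cut; `κ₀ = 1`): constant
`3(#κ+1)(1+Q)∕(1·(1−ρ))`.  LOCATED junction; other binders displayed unchanged. [textbook] -/
theorem slotAntiConcentration_restrict_of_projectedCentre_superhomogeneous [Nonempty κ] (ζ : Measure X) [SFinite ζ]
    (K : X → Set (κ → ℝ)) (A : Matrix κ κ ℝ) (hA : A.IsSymm) {γ G : ℝ} (hγ0 : 0 < γ)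
    (hγ : ∀ x : κ → ℝ, γ * ‖x‖ ^ 2 ≤ x ⬝ᵥ (A *ᵥ x))
    (m : X → (κ → ℝ)) {c : X → (κ → ℝ)} (hc : Measurable c) (Pz : X → (κ → ℝ) → ℝ)
    (hg : Measurable fun p : X × (κ → ℝ) => (K p.1).indicator (fun w => ENNReal.ofReal (Real.exp
      (-(1 / 2 * ((w - m p.1) ⬝ᵥ (A *ᵥ (w - m p.1))) + Pz p.1 w)))) p.2)
    {U : X × (κ → ℝ) → ℝ} (hUm : Measurable U)
    {C Env : Set (X × (κ → ℝ))} (hC : MeasurableSet C) (hEnv : MeasurableSet Env)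
    (hhom : ∀ p ∈ C, ∀ s : ℝ, 1 ≤ s → (p.1, c p.1 + s • (p.2 - c p.1)) ∈ C →
      s * U p ≤ U (p.1, c p.1 + s • (p.2 - c p.1)))
    {θ ρ Q : ℝ} (hθ : 0 < θ) (hρ0 : 0 < ρ) (hρ1 : ρ < 1) (hQ0 : 0 ≤ Q)
    (hK : ∀ z, Convex ℝ (K z)) (hcK : ∀ z, c z ∈ K z)
    (hP : ∀ z, ∀ v ∈ K z, ∀ v' ∈ K z, Pz z v - Pz z v' ≤ G * ‖v - v'‖)
    (hobt : ∀ p : X × (κ → ℝ), θ * (1 - ρ) ≤ U p → U p < θ → p ∈ C → p.2 ∈ K p.1 →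
      0 ≤ (c p.1 - m p.1) ⬝ᵥ (A *ᵥ (p.2 - c p.1)))
    (hfar : ∀ p : X × (κ → ℝ), θ * (1 - ρ) ≤ U p → U p < θ → p ∈ C → p.2 ∈ K p.1 →
      2 * G ≤ γ * ‖p.2 - c p.1‖)
    (henv : ∀ l ∈ Icc (1 - 1 / ((Fintype.card κ : ℝ) + 1)) 1, ∀ p : X × (κ → ℝ),
      θ * (1 - ρ) ≤ U p → U p < θ → p ∈ C → (p.1, c p.1 + l • (p.2 - c p.1)) ∈ Env)
    (hQ : ((ζ.prod volume).withDensity fun p : X × (κ → ℝ) => (K p.1).indicator (fun w => ENNReal.ofReal (Real.exp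
        (-(1 / 2 * ((w - m p.1) ⬝ᵥ (A *ᵥ (w - m p.1))) + Pz p.1 w)))) p.2) (Env \ ({p | U p < θ} ∩ C))
      ≤ ENNReal.ofReal Q * ((ζ.prod volume).withDensity fun p : X × (κ → ℝ) => (K p.1).indicator (fun w =>
        ENNReal.ofReal (Real.exp (-(1 / 2 * ((w - m p.1) ⬝ᵥ (A *ᵥ (w - m p.1))) + Pz p.1 w)))) p.2)
        ({p | U p < θ} ∩ C)) :
    SlotAntiConcentration
      ((((ζ.prod volume).withDensity fun p : X × (κ → ℝ) => (K p.1).indicator (fun w => ENNReal.ofReal (Real.exp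
          (-(1 / 2 * ((w - m p.1) ⬝ᵥ (A *ᵥ (w - m p.1))) + Pz p.1 w)))) p.2)).restrict ({p | U p < θ} ∩ C))
      U θ ρ (3 * ((Fintype.card κ : ℝ) + 1) * (1 + Q) / (1 * (1 - ρ))) :=
  slotAntiConcentration_restrict_of_projectedCentre ζ K A hA hγ0 hγ m hc Pz hg hUm hC hEnv hθ hρ0 hρ1 one_pos hQ0
    hK hcK hP hobt hfar henv (hRT_of_superhomogeneous U c hhom) hQ

end Junction

/-! ## §3  A2/A6: the hypothesis is inhabited by a non-trivial statistic -/

/-- **A2/A6 — THE SUPER-HOMOGENEITY HYPOTHESIS IS INHABITED (WITH EQUALITY) BY A NON-TRIVIAL STATISTIC**: the sup-norm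
distance to a non-zero centre, `U p = ‖p.2 − c‖` on `Unit × (Fin 2 → ℝ)` with `c = (1, 1)`, any cut; and `U` is not
identically zero. [textbook] -/
theorem superhomogeneous_letters_inhabited :
    (∀ p ∈ (univ : Set (Unit × (Fin 2 → ℝ))), ∀ s : ℝ, 1 ≤ s →
        (p.1, (fun _ : Unit => fun _ : Fin 2 => (1 : ℝ)) p.1 + s • (p.2 - (fun _ : Unit => fun _ : Fin 2 => (1 : ℝ)) p.1))
          ∈ (univ : Set (Unit × (Fin 2 → ℝ))) →
        s * ‖p.2 - fun _ : Fin 2 => (1 : ℝ)‖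
          ≤ ‖((fun _ : Unit => fun _ : Fin 2 => (1 : ℝ)) p.1 + s • (p.2 - (fun _ : Unit => fun _ : Fin 2 => (1 : ℝ)) p.1))
              - fun _ : Fin 2 => (1 : ℝ)‖) ∧
    ∃ p : Unit × (Fin 2 → ℝ), ‖p.2 - fun _ : Fin 2 => (1 : ℝ)‖ ≠ 0 := by
  refine ⟨fun p _ s hs _ => ?_, ⟨((), fun _ => 0), ?_⟩⟩
  · have h := superhomogeneous_of_linear_norm (X := Unit) (V := Fin 2 → ℝ) (E := Fin 2 → ℝ)
      (fun _ => LinearMap.id) (fun _ => fun _ : Fin 2 => (1 : ℝ)) p (by linarith : (0 : ℝ) ≤ s)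
    simp only [LinearMap.id_coe, id_eq] at h
    exact h.le
  · rw [norm_ne_zero_iff, sub_ne_zero]
    intro h
    have := congrFun h 0
    norm_num at this

end Summit.QuantumFields.YangMills.Theorems.N21HomogeneousStatisticRadialTransversality
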